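import Summits.Ventures.HodgeRepro2.T5InertTopCoefficient
import Summits.Ventures.HodgeRepro2.T5HeckeCharacterParameter
import Summits.Ventures.HodgeRepro2.T5HeckeEigencharacterDetermines

/-!
# The spherical Hecke algebra at an inert place: characters, monic Hecke polynomials, and
«an unramified representation is determined by its `T₁`-eigenvalue» — with no hypothesis left
(cell pub-hodge-repro2, seat p3)

Tier-5 N3 support. File 187 discharged the leading-term property `hlead` of seat p8's T5-180
(`mul_sub_mem_span`), so every consumer that p8 stated «given `hlead`» now closes unconditionally on
`H(U(antidiag(1, u, 1)), K)` over a DVR `R` with finite residue field (the star preserving `R`, `u` a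
star-fixed unit, `ϖ` a star-fixed uniformiser):

* abstract (T5-180's setting — a basis `T : ℕ → A` with `T 0 = 1` and the leading-term property):
  **`exists_monic_aeval_eq`** — for every `n` there is a MONIC polynomial `Pₙ` of degree `n` with
  `Pₙ(T₁) = Tₙ` (the family is built by induction: `P_{n+1} = X · Pₙ − Σ cᵢ Pᵢ` with the `cᵢ` read off
  the span witness of `hlead`); `existsUnique_aeval_eq` (that polynomial is unique: `aeval T₁` is
  bijective); `apply_eq_aeval` (under any character `χ`, `χ(Tₙ) = Pₙ(χ(T₁))`);
* on the inert-place Hecke algebra: `mul_comm'` (commutativity, from the polynomial structure),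
  **`algHom_ext`** / **`exists_algHom_apply_eq`** / `existsUnique_algHom_apply_eq` /
  **`bijective_apply_one`** / `nonempty_algHom_equiv` (`χ ↦ χ(T₁)` is a bijection
  `(H →ₐ[k] C) ≃ C`: a character of `H(U, K)` IS one number — its `T₁`-value, the Satake parameter
  read as the `T₁`-eigenvalue), `exists_monic_aeval_eq'` / **`exists_monic_forall_apply_eq`** (every
  Hecke eigenvalue `χ(Tₙ)` is the value at `χ(T₁)` of a monic polynomial of degree `n` that depends
  only on `(R, u, ϖ)`, not on `χ`), `apply_eq_of_apply_one_eq`;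
* **`nonempty_equiv_iff_heckeCharacter_apply_one_eq`** — for two irreducible `K`-finite representations
  of `U(J₃(u))` with non-zero finite-dimensional `K`-invariants (`k` algebraically closed of
  characteristic `0`): `ρ ≅ ρ′ ↔ χ_ρ(T₁) = χ_{ρ′}(T₁)` — p8's T5-85 «the eigencharacter determines the
  representation» with the eigencharacter collapsed to its `T₁`-value (`_of_hcomm` keeps the
  commutativity and finite-orbit hypotheses explicit; the unprimed version discharges both).

Mathlib + this seat's file 187 + seat p8's T5-85 / T5-180 / T5-186 and their imports; no display; no
device. §8(d): uses an L-value-free non-vanishing device: NO.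
-/

namespace Summit.Ventures.HodgeRepro2.T5InertHeckeCharacter

open Summit.Ventures.HodgeRepro2.T5HeckeBasisCells Summit.Ventures.HodgeRepro2.T5HeckePermutationModule
  Summit.Ventures.HodgeRepro2.T5HeckeCharacterParameter Summit.Ventures.HodgeRepro2.T5HeckePolynomialAlgebra
  Summit.Ventures.HodgeRepro2.T5UnitaryHeckeAdjoint Summit.Ventures.HodgeRepro2.T5HermitianThreeElements
  Summit.Ventures.HodgeRepro2.T5UnitaryGroupForm Summit.Ventures.HodgeRepro2.T5InertTopCoefficient
  Summit.Ventures.HodgeRepro2.T5HeckeCommutativeMultiplicityOne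
  Summit.Ventures.HodgeRepro2.T5HeckeEigencharacterDetermines Summit.Ventures.HodgeRepro2.T5LevelIdempotent
  Summit.Ventures.HodgeRepro2.LevelPositivity

/-! ## The abstract setting of T5-180: a basis with the leading-term property -/

section Abstract

variable {k : Type*} [Field k] {B : Type*} [Ring B] [Algebra k B] {A : Subalgebra k B}
  (T : Module.Basis ℕ k A) (hT0 : T 0 = 1)
  (hlead : ∀ n : ℕ, T 1 * T n - T (n + 1) ∈ Submodule.span k (T '' {i | i < n + 1}))

include hT0 hlead in
/-- **The monic Hecke polynomials, as a family**: for every `n` there are polynomials `P 0, …, P n`,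
`P m` monic of degree `m`, with `P m (T 1) = T m`. -/
theorem exists_family_monic_aeval_eq (n : ℕ) :
    ∃ P : ℕ → Polynomial k, ∀ m ≤ n, (P m).Monic ∧ (P m).natDegree = m ∧
      Polynomial.aeval (T 1) (P m) = T m := by
  induction n with
  | zero =>
    refine ⟨fun _ => 1, fun m hm => ?_⟩
    obtain rfl : m = 0 := Nat.le_zero.mp hm
    exact ⟨Polynomial.monic_one, Polynomial.natDegree_one, by rw [Polynomial.aeval_one, hT0]⟩
  | succ n ih =>
    obtain ⟨P, hP⟩ := ih
    obtain ⟨t, ht, c, hc⟩ := (Submodule.mem_span_image_iff_exists_fun k).1 (hlead n)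
    have hlt_t : ∀ i : t, (i : ℕ) ≤ n := fun i =>
      Nat.lt_succ_iff.mp (ht (Finset.mem_coe.mpr i.2))
    have hQdeg : (∑ i : t, c i • P i).natDegree ≤ n := by
      refine Polynomial.natDegree_sum_le_of_forall_le _ _ fun i _ => ?_
      refine (Polynomial.natDegree_smul_le _ _).trans ?_
      rw [(hP i (hlt_t i)).2.1]
      exact hlt_t i
    have hQev : Polynomial.aeval (T 1) (∑ i : t, c i • P i) = T 1 * T n - T (n + 1) := by
      rw [← hc, map_sum]
      refine Finset.sum_congr rfl fun i _ => ?_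
      rw [map_smul, (hP i (hlt_t i)).2.2]
    have hXP : (Polynomial.X * P n).Monic := Polynomial.monic_X.mul (hP n le_rfl).1
    have hXPdeg : (Polynomial.X * P n).natDegree = n + 1 := by
      rw [Polynomial.natDegree_X_mul (hP n le_rfl).1.ne_zero, (hP n le_rfl).2.1]
    have hlt : (∑ i : t, c i • P i).natDegree < (Polynomial.X * P n).natDegree := by omega
    refine ⟨Function.update P (n + 1) (Polynomial.X * P n - ∑ i : t, c i • P i), fun m hm => ?_⟩
    by_cases hm' : m = n + 1
    · subst hm'
      rw [Function.update_self]
      refine ⟨hXP.sub_of_left (Polynomial.degree_lt_degree hlt), ?_, ?_⟩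
      · rw [Polynomial.natDegree_sub_eq_left_of_natDegree_lt hlt, hXPdeg]
      · rw [Polynomial.aeval_sub, Polynomial.aeval_mul, Polynomial.aeval_X, (hP n le_rfl).2.2, hQev,
          sub_sub_cancel]
    · rw [Function.update_of_ne hm']
      exact hP m (Nat.lt_succ_iff.mp (lt_of_le_of_ne hm hm'))

include hT0 hlead in
/-- **The monic Hecke polynomial `Pₙ`**: monic of degree `n` with `Pₙ(T₁) = Tₙ`. -/
theorem exists_monic_aeval_eq (n : ℕ) :
    ∃ P : Polynomial k, P.Monic ∧ P.natDegree = n ∧ Polynomial.aeval (T 1) P = T n := by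
  obtain ⟨P, hP⟩ := exists_family_monic_aeval_eq T hT0 hlead n
  exact ⟨P n, hP n le_rfl⟩

include hT0 hlead in
/-- The polynomial with `P(T₁) = Tₙ` is unique (`aeval T₁` is bijective, T5-180). -/
theorem existsUnique_aeval_eq (n : ℕ) : ∃! P : Polynomial k, Polynomial.aeval (T 1) P = T n :=
  (aeval_bijective T hT0 hlead).existsUnique (T n)

/-- Under any `k`-algebra homomorphism `χ`, `P(T₁) = Tₙ` gives `χ(Tₙ) = P(χ(T₁))`. -/
theorem apply_eq_aeval {C : Type*} [Semiring C] [Algebra k C] (χ : A →ₐ[k] C) {P : Polynomial k}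
    {n : ℕ} (hP : Polynomial.aeval (T 1) P = T n) :
    χ (T n) = Polynomial.aeval (χ (T 1)) P := by
  rw [Polynomial.aeval_algHom_apply, hP]

end Abstract

/-! ## The inert-place Hecke algebra `H(U(antidiag(1, u, 1)), K)` -/

section Inert

variable {R E : Type*} [CommRing R] [Field E] [StarRing E] [Algebra R E] [IsFractionRing R E] [IsDomain R]
  [IsDiscreteValuationRing R] [Finite (IsLocalRing.ResidueField R)]
  (hstar : ∀ x : E, IsLocalization.IsInteger R x → IsLocalization.IsInteger R (star x))
  (u : E) (hsu : star u = u) (hu0 : u ≠ 0) (hu : IsLocalization.IsInteger R u)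
  (hu' : IsLocalization.IsInteger R u⁻¹) {ϖ : R} (hϖ : Irreducible ϖ)
  (hs : star (algebraMap R E ϖ) = algebraMap R E ϖ) (k : Type*) [Field k]

include hstar hsu hu0 hu hu' hϖ hs in
/-- **Commutativity of `H(U(J₃(u)), K)`** from its polynomial structure (p8's T5-180
`heckeAlgebra_mul_comm_of_leading` with `hlead` discharged by file 187). -/
theorem mul_comm' (a b : heckeAlgebra k (hyperspecialSubgroup R (J3 u))) : a * b = b * a :=
  heckeAlgebra_mul_comm_of_leading hstar u hsu hu0 hu hu' hϖ hs k
    (mul_sub_mem_span hstar u hsu hu0 hu hu' hϖ hs k) a b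

/-- **A character of `H(U(J₃(u)), K)` is determined by its `T₁`-value** (p8's T5-186 with `hlead`
discharged). -/
theorem algHom_ext {C : Type*} [Semiring C] [Algebra k C]
    {χ χ' : heckeAlgebra k (hyperspecialSubgroup R (J3 u)) →ₐ[k] C}
    (h : χ (heckeBasisCells hstar u hsu hu0 hu hu' hϖ hs k 1) =
      χ' (heckeBasisCells hstar u hsu hu0 hu hu' hϖ hs k 1)) : χ = χ' :=
  heckeAlgebra_algHom_ext_of_leading hstar u hsu hu0 hu hu' hϖ hs k
    (mul_sub_mem_span hstar u hsu hu0 hu hu' hϖ hs k) h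

/-- **Every value is a `T₁`-value**: for every `c` there is a character `χ` with `χ(T₁) = c` (p8's
T5-186 with `hlead` discharged). -/
theorem exists_algHom_apply_eq {C : Type*} [Semiring C] [Algebra k C] (c : C) :
    ∃ χ : heckeAlgebra k (hyperspecialSubgroup R (J3 u)) →ₐ[k] C,
      χ (heckeBasisCells hstar u hsu hu0 hu hu' hϖ hs k 1) = c :=
  heckeAlgebra_exists_algHom_apply_eq hstar u hsu hu0 hu hu' hϖ hs k
    (mul_sub_mem_span hstar u hsu hu0 hu hu' hϖ hs k) c

/-- **`χ ↦ χ(T₁)` is a bijection** from the characters of `H(U(J₃(u)), K)` with values in `C` onto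
`C`: a character is one number, its `T₁`-eigenvalue. -/
theorem bijective_apply_one {C : Type*} [Semiring C] [Algebra k C] :
    Function.Bijective fun χ : heckeAlgebra k (hyperspecialSubgroup R (J3 u)) →ₐ[k] C =>
      χ (heckeBasisCells hstar u hsu hu0 hu hu' hϖ hs k 1) :=
  T5HeckeCharacterParameter.bijective_apply_one (heckeBasisCells hstar u hsu hu0 hu hu' hϖ hs k)
    (heckeBasisCells_zero hstar u hsu hu0 hu hu' hϖ hs k)
    (mul_sub_mem_span hstar u hsu hu0 hu hu' hϖ hs k)

/-- For every `c` there is exactly one character with `χ(T₁) = c`. -/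
theorem existsUnique_algHom_apply_eq {C : Type*} [Semiring C] [Algebra k C] (c : C) :
    ∃! χ : heckeAlgebra k (hyperspecialSubgroup R (J3 u)) →ₐ[k] C,
      χ (heckeBasisCells hstar u hsu hu0 hu hu' hϖ hs k 1) = c :=
  (bijective_apply_one hstar u hsu hu0 hu hu' hϖ hs k).existsUnique c

include hstar hsu hu0 hu hu' hϖ hs in
/-- The characters of `H(U(J₃(u)), K)` with values in `C` are in bijection with `C`. -/
theorem nonempty_algHom_equiv {C : Type*} [Semiring C] [Algebra k C] :
    Nonempty ((heckeAlgebra k (hyperspecialSubgroup R (J3 u)) →ₐ[k] C) ≃ C) :=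
  ⟨Equiv.ofBijective _ (bijective_apply_one hstar u hsu hu0 hu hu' hϖ hs k)⟩

/-- **The monic Hecke polynomial of the inert place**: `Tₙ = Pₙ(T₁)` with `Pₙ` monic of degree `n`. -/
theorem exists_monic_aeval_eq' (n : ℕ) :
    ∃ P : Polynomial k, P.Monic ∧ P.natDegree = n ∧
      Polynomial.aeval (heckeBasisCells hstar u hsu hu0 hu hu' hϖ hs k 1) P =
        heckeBasisCells hstar u hsu hu0 hu hu' hϖ hs k n :=
  exists_monic_aeval_eq (heckeBasisCells hstar u hsu hu0 hu hu' hϖ hs k)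
    (heckeBasisCells_zero hstar u hsu hu0 hu hu' hϖ hs k)
    (mul_sub_mem_span hstar u hsu hu0 hu hu' hϖ hs k) n

universe v in
/-- **Every Hecke eigenvalue is a polynomial in the `T₁`-eigenvalue**: there is a monic `Pₙ` of degree
`n`, depending only on `(R, u, ϖ)`, with `χ(Tₙ) = Pₙ(χ(T₁))` for EVERY character `χ` (with values in
any `k`-algebra). -/
theorem exists_monic_forall_apply_eq (n : ℕ) :
    ∃ P : Polynomial k, P.Monic ∧ P.natDegree = n ∧
      ∀ {C : Type v} [Semiring C] [Algebra k C]
        (χ : heckeAlgebra k (hyperspecialSubgroup R (J3 u)) →ₐ[k] C),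
        χ (heckeBasisCells hstar u hsu hu0 hu hu' hϖ hs k n) =
          Polynomial.aeval (χ (heckeBasisCells hstar u hsu hu0 hu hu' hϖ hs k 1)) P := by
  obtain ⟨P, hP1, hP2, hP3⟩ := exists_monic_aeval_eq' hstar u hsu hu0 hu hu' hϖ hs k n
  exact ⟨P, hP1, hP2, fun χ => apply_eq_aeval _ χ hP3⟩

/-- Two characters with the same `T₁`-value agree on every `Tₙ`. -/
theorem apply_eq_of_apply_one_eq {C : Type*} [Semiring C] [Algebra k C]
    {χ χ' : heckeAlgebra k (hyperspecialSubgroup R (J3 u)) →ₐ[k] C}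
    (h : χ (heckeBasisCells hstar u hsu hu0 hu hu' hϖ hs k 1) =
      χ' (heckeBasisCells hstar u hsu hu0 hu hu' hϖ hs k 1)) (n : ℕ) :
    χ (heckeBasisCells hstar u hsu hu0 hu hu' hϖ hs k n) =
      χ' (heckeBasisCells hstar u hsu hu0 hu hu' hϖ hs k n) := by
  rw [algHom_ext hstar u hsu hu0 hu hu' hϖ hs k h]

/-! ## An unramified representation is determined by its `T₁`-eigenvalue -/

/-- **`ρ ≅ ρ′ ↔ χ_ρ(T₁) = χ_{ρ′}(T₁)`** (explicit commutativity / finite-orbit hypotheses): two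
irreducible `K`-finite representations of `U(J₃(u))` with non-zero finite-dimensional `K`-invariants are
isomorphic iff their Hecke eigencharacters take the same value on `T₁` (p8's T5-85
`nonempty_equiv_iff_heckeCharacterAlgHom_eq` + `algHom_ext`). -/
theorem nonempty_equiv_iff_heckeCharacter_apply_one_eq_of_hcomm [CharZero k] [IsAlgClosed k]
    {V : Type*} [AddCommGroup V] [Module k V] {V' : Type*} [AddCommGroup V'] [Module k V']
    (ρ : Representation k (formUnitaryGroup (J3 u)) V)
    (ρ' : Representation k (formUnitaryGroup (J3 u)) V') [ρ.IsIrreducible] [ρ'.IsIrreducible]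
    (hK : KFinite ρ (hyperspecialSubgroup R (J3 u))) (hK' : KFinite ρ' (hyperspecialSubgroup R (J3 u)))
    (hfin : ∀ g : formUnitaryGroup (J3 u), Finite (MulAction.orbit (hyperspecialSubgroup R (J3 u))
      (g : formUnitaryGroup (J3 u) ⧸ hyperspecialSubgroup R (J3 u))))
    [FiniteDimensional k (invariants ρ (hyperspecialSubgroup R (J3 u)))]
    [FiniteDimensional k (invariants ρ' (hyperspecialSubgroup R (J3 u)))]
    (hne : invariants ρ (hyperspecialSubgroup R (J3 u)) ≠ ⊥)
    (hne' : invariants ρ' (hyperspecialSubgroup R (J3 u)) ≠ ⊥)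
    (hcomm : ∀ T S : heckeAlgebra k (hyperspecialSubgroup R (J3 u)), T * S = S * T) :
    Nonempty (ρ.Equiv ρ') ↔
      heckeCharacter ρ hK hfin hne hcomm (heckeBasisCells hstar u hsu hu0 hu hu' hϖ hs k 1) =
        heckeCharacter ρ' hK' hfin hne' hcomm (heckeBasisCells hstar u hsu hu0 hu hu' hϖ hs k 1) := by
  rw [nonempty_equiv_iff_heckeCharacterAlgHom_eq ρ ρ' hK hK' hfin hne hne' hcomm,
    ← heckeCharacterAlgHom_apply, ← heckeCharacterAlgHom_apply]
  exact ⟨fun h => by rw [h], fun h => algHom_ext hstar u hsu hu0 hu hu' hϖ hs k h⟩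

/-- **An unramified representation of `U(J₃(u))` is determined by its `T₁`-eigenvalue**: with the
commutativity of `H(U, K)` (`mul_comm'`) and the finiteness of the `K`-orbits (p8's T5-1xx instance)
discharged. -/
theorem nonempty_equiv_iff_heckeCharacter_apply_one_eq [CharZero k] [IsAlgClosed k]
    {V : Type*} [AddCommGroup V] [Module k V] {V' : Type*} [AddCommGroup V'] [Module k V']
    (ρ : Representation k (formUnitaryGroup (J3 u)) V)
    (ρ' : Representation k (formUnitaryGroup (J3 u)) V') [ρ.IsIrreducible] [ρ'.IsIrreducible]
    (hK : KFinite ρ (hyperspecialSubgroup R (J3 u))) (hK' : KFinite ρ' (hyperspecialSubgroup R (J3 u)))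
    [FiniteDimensional k (invariants ρ (hyperspecialSubgroup R (J3 u)))]
    [FiniteDimensional k (invariants ρ' (hyperspecialSubgroup R (J3 u)))]
    (hne : invariants ρ (hyperspecialSubgroup R (J3 u)) ≠ ⊥)
    (hne' : invariants ρ' (hyperspecialSubgroup R (J3 u)) ≠ ⊥) :
    Nonempty (ρ.Equiv ρ') ↔
      heckeCharacter ρ hK (fun _ => inferInstance) hne (mul_comm' hstar u hsu hu0 hu hu' hϖ hs k)
          (heckeBasisCells hstar u hsu hu0 hu hu' hϖ hs k 1) =
        heckeCharacter ρ' hK' (fun _ => inferInstance) hne' (mul_comm' hstar u hsu hu0 hu hu' hϖ hs k)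
          (heckeBasisCells hstar u hsu hu0 hu hu' hϖ hs k 1) :=
  nonempty_equiv_iff_heckeCharacter_apply_one_eq_of_hcomm hstar u hsu hu0 hu hu' hϖ hs k ρ ρ' hK hK'
    (fun _ => inferInstance) hne hne' (mul_comm' hstar u hsu hu0 hu hu' hϖ hs k)

end Inert

end Summit.Ventures.HodgeRepro2.T5InertHeckeCharacter
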